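import Literature.Probability.RandomPlanarGeometry.HullExhaustion
import Literature.Probability.RandomPlanarGeometry.HullSubdomainAccess
import HarnessLib

/-!
# The SLE_{8/3} trace touching a Jordan hull without entering it is a null event

Step T6c of the transposition of [LSW] Thm. 6.1 to `Literature.Probability.RandomPlanarGeometry.IsSLELaw.hullRestriction_eightThirds`
(plan in `ConformalRestrictionProofs`):

* G. F. Lawler, O. Schramm, W. Werner, *Conformal restriction: the chordal case*, J. Amer. Math.
  Soc. **16** (2003), arXiv:math/0209343 (**[LSW]**), Thm. 6.1 (p. 23).

Let `φ` be a chordal uniformizing map of `(D; a, b)`, `D'` a hull subdomain and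
`A = closure (ℍ ∖ φ⁻¹ D')` the pulled-back `*`-hull (`HullSubdomainPullback`). The tree's
restriction property conditions on `{Γ ⊆ cl D'}`, which for the SLE curve `Γ = φ(γ)` reads
`{γ(0, ∞) ⊆ closure (ℍ ∖ A)}`; [LSW] Thm. 6.1 concerns `{γ ∩ A = ∅}`. We PROVE
(`measure_subset_closure_le_measure_avoid`)

  `P[γ(0,∞) ⊆ closure (ℍ ∖ A)] ≤ P[γ[0,∞) ∩ A = ∅]`,

whence the two events agree almost surely (the reverse inclusion holding for simple traces).
Proof: the erosions `S_n = {Im ≥ 0, |·| ≤ n+1, dist(·, closure (ℍ ∖ A)) ≥ 1/(n+1)}` have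
anchored hulls `B_n = anchoredHull S_n ∈ 𝒬*` (`HullExhaustion`) increasing inside `A`, whose
complements have kernel `ℍ ∖ A` — every point of `ℍ` off `closure (ℍ ∖ A)` is joined to `−i`
off `closure (ℍ ∖ A)` (`HullSubdomainAccess.joinedIn_compl_closure_pullbackDomain`, Jordan
curve theorem and Carathéodory), hence anchored in some `S_n`; and no point of `∂A ∩ ℍ` is
interior to `closure (ℍ ∖ A)` (the frontier of a Jordan domain is the frontier of its
exterior). A trace with `γ(0,∞) ⊆ closure (ℍ ∖ A)` misses every `S_n`, hence every `B_n`
(transience), so `P[γ(0,∞) ⊆ closure (ℍ ∖ A)] ≤ P[γ ∩ B_n = ∅] = Φ'_{B_n}(0)^{5/8}` (Thm. 6.1),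
which tends to `Φ'_A(0)^{5/8} = P[γ ∩ A = ∅]` by the continuity of `Φ'_·(0)` under kernel
convergence (named fact `HasRestrictionDeriv.tendsto_of_kernel`, [LSW] Lemma 3.5).
-/

noncomputable section

open Set Filter Topology Metric MeasureTheory Complex
open UpperHalfPlane (upperHalfPlaneSet isOpen_upperHalfPlaneSet)
open scoped NNReal ENNReal

namespace Literature.Probability.RandomPlanarGeometry

section Null

variable {D D' : DobrushinDomain} {φ : ConformalEquiv upperHalfPlaneSet D.carrier}

/-- The **erosion test sets** of the pulled-back domain: points of the closed half-plane of
modulus `≤ n+1` at distance `≥ 1/(n+1)` from `closure (ℍ ∖ A) = closure (φ⁻¹ D')`. [folklore] -/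
def erosion (φ : ConformalEquiv upperHalfPlaneSet D.carrier) (D' : DobrushinDomain) (n : ℕ) :
    Set ℂ :=
  {w : ℂ | 0 ≤ w.im ∧ ‖w‖ ≤ n + 1 ∧
    1 / ((n : ℝ) + 1) ≤ infDist w (closure (φ.pullbackDomain D'))}

/-- Erosions are closed. [folklore] -/
theorem isClosed_erosion (n : ℕ) : IsClosed (erosion φ D' n) :=
  (isClosed_le continuous_const continuous_im).inter
    ((isClosed_le continuous_norm continuous_const).inter
      (isClosed_le continuous_const (continuous_infDist_pt _)))

/-- Erosions are bounded. [folklore] -/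
theorem isBounded_erosion (n : ℕ) : Bornology.IsBounded (erosion φ D' n) :=
  (isBounded_closedBall (x := (0 : ℂ)) (r := n + 1)).subset fun _ hw ↦
    mem_closedBall_zero_iff.2 hw.2.1

/-- Erosions increase with `n`. [folklore] -/
theorem monotone_erosion : Monotone (erosion φ D') := by
  intro n m hnm w hw
  have h1 : (n : ℝ) + 1 ≤ m + 1 := by exact_mod_cast Nat.succ_le_succ hnm
  refine ⟨hw.1, hw.2.1.trans h1, le_trans ?_ hw.2.2⟩
  exact one_div_le_one_div_of_le (by positivity) h1

/-- Erosions miss `closure (ℍ ∖ A)`. [folklore] -/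
theorem erosion_disjoint_closure (n : ℕ) :
    Disjoint (erosion φ D' n) (closure (φ.pullbackDomain D')) := by
  refine Set.disjoint_left.2 fun w hw hwcl ↦ ?_
  have h0 : infDist w (closure (φ.pullbackDomain D')) = 0 := infDist_zero_of_mem hwcl
  have := hw.2.2
  rw [h0] at this
  exact absurd this (not_le.2 (by positivity))

/-- Points of the closure of the pulled-back domain are mapped into `closure D'`. [folklore] -/
theorem apply_mem_closure_of_mem_closure {z : ℂ} (hz : z ∈ upperHalfPlaneSet)
    (hzc : z ∈ closure (φ.pullbackDomain D')) : φ z ∈ closure D'.carrier := by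
  have h1 : ContinuousWithinAt φ (φ.pullbackDomain D') z :=
    (φ.continuousOn z hz).mono ConformalEquiv.pullbackDomain_subset
  refine closure_mono ?_ (h1.mem_closure_image hzc)
  rintro _ ⟨u, hu, rfl⟩
  exact hu.2

/-- Points of `closure (ℍ ∖ A)`, in particular `0`, are in no erosion. [folklore] -/
theorem notMem_erosion_of_mem_closure {w : ℂ} (hw : w ∈ closure (φ.pullbackDomain D')) (n : ℕ) :
    w ∉ erosion φ D' n :=
  fun h ↦ Set.disjoint_left.1 (erosion_disjoint_closure n) h hw

variable (hφ : D.IsChordalUniformizing φ) (hD' : D.IsHullSubdomain D')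
include hφ hD'

/-- `ℍ ∖ A` lies in the unbounded component of the complement of every erosion (it is
connected, unbounded and misses the erosion). [folklore] -/
theorem pullbackDomain_subset_unboundedComponent (hsc : ∀ D : JordanDomain, D.isSimplyConnected)
    (n : ℕ) : φ.pullbackDomain D' ⊆
      Loewner.unboundedComponent (upperHalfPlaneSet \ erosion φ D' n) := by
  have hA : IsStarHull (φ.pullbackHull D') := IsStarHull.pullbackHull hsc hφ hD'
  have hconn : IsPreconnected (φ.pullbackDomain D') := by
    rw [← ConformalEquiv.diff_pullbackHull]
    exact hA.isBoundedHull.2.2.isPathConnected.isConnected.isPreconnected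
  refine subset_unboundedComponent_of_isPreconnected hconn ?_ ?_
  · intro w hw
    exact ⟨hw.1, fun h ↦ Set.disjoint_left.1 (erosion_disjoint_closure n) h (subset_closure hw)⟩
  · intro hb
    -- `ℍ ∖ A` contains a vertical ray
    obtain ⟨R, hR⟩ := hA.isBoundedHull.1.subset_closedBall 0
    obtain ⟨h1, h2⟩ := farPoint_mem R
    have hray : upRay (((|R| + 1 : ℝ) : ℂ) * I) ⊆ φ.pullbackDomain D' := by
      rw [← ConformalEquiv.diff_pullbackHull]
      intro w hw
      obtain ⟨hwH, hwB⟩ := upRay_subset (subset_refl (closedBall (0 : ℂ) R)) h1 h2 hw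
      exact ⟨hwH, fun h ↦ hwB (hR h)⟩
    exact not_isBounded_upRay _ (hb.subset hray)

/-- The fill of an erosion lies inside `A`; in particular `0 ∉ hpFill (erosion n)`. [folklore] -/
theorem hpFill_erosion_subset (hsc : ∀ D : JordanDomain, D.isSimplyConnected) (n : ℕ) :
    hpFill (erosion φ D' n) ⊆ φ.pullbackHull D' := by
  refine (ConformalEquiv.isClosed_pullbackHull).closure_subset_iff.2 ?_
  rintro w ⟨hw, hwV⟩
  by_contra hwA
  have : w ∈ φ.pullbackDomain D' := by
    rw [← ConformalEquiv.diff_pullbackHull]; exact ⟨hw, hwA⟩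
  exact hwV (pullbackDomain_subset_unboundedComponent hφ hD' hsc n this)

/-- The anchored hulls of the erosions lie inside `A`. [folklore] -/
theorem anchoredHull_erosion_subset (hsc : ∀ D : JordanDomain, D.isSimplyConnected) (n : ℕ) :
    anchoredHull (erosion φ D' n) ⊆ φ.pullbackHull D' :=
  (anchoredHull_subset_hpFill _).trans (hpFill_erosion_subset hφ hD' hsc n)

/-- **The anchored hulls of the erosions are `*`-hulls** (given the classical criterion
`isSimplyConnected_of_isConnected_compl`, hypothesis `hFa`). [folklore] -/
theorem isStarHull_anchoredHull_erosion (hsc : ∀ D : JordanDomain, D.isSimplyConnected)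
    (hFa : isSimplyConnected_of_isConnected_compl) (n : ℕ) :
    IsStarHull (anchoredHull (erosion φ D' n)) := by
  have hA : IsStarHull (φ.pullbackHull D') := IsStarHull.pullbackHull hsc hφ hD'
  have h0 : (0 : ℂ) ∉ hpFill (erosion φ D' n) := fun h ↦
    hA.zero_notMem (hpFill_erosion_subset hφ hD' hsc n h)
  exact isStarHull_anchoredHull hFa (isClosed_erosion n) (isBounded_erosion n) h0

/-- `0 ∈ closure (ℍ ∖ A)`, so the closure of the pulled-back domain is nonempty and contains
`0`. [folklore] -/
theorem zero_mem_closure_pullbackDomain (hsc : ∀ D : JordanDomain, D.isSimplyConnected) :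
    (0 : ℂ) ∈ closure (φ.pullbackDomain D') := by
  rw [← ConformalEquiv.diff_pullbackHull]
  exact (IsStarHull.pullbackHull hsc hφ hD').zero_mem_closure_diff

/-- **A point of `ℍ` off `closure (ℍ ∖ A)` lies in the anchored hull of some erosion**: join it
to `−i` off `closure (ℍ ∖ A)` (`joinedIn_compl_closure_pullbackDomain`); the compact path
keeps a positive distance from `closure (ℍ ∖ A)` and a bounded modulus, so its upper part lies
in a far enough erosion, and the path exhibits the point in the anchor component. [folklore] -/
theorem exists_mem_anchoredHull_erosion (hsc : ∀ D : JordanDomain, D.isSimplyConnected)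
    (hJ : Literature.Topology.PlaneTopology.JordanCurveTheorem) (hC : JordanDomain.exists_continuousOn_extension) {z : ℂ}
    (hz : z ∈ upperHalfPlaneSet) (hzc : z ∉ closure (φ.pullbackDomain D')) :
    ∃ n, z ∈ anchoredHull (erosion φ D' n) := by
  have hb : D.pt 1 ∈ closure D'.carrier := by
    rw [← hD'.pt_one_eq]; exact frontier_subset_closure (D'.pt_mem_frontier 1)
  obtain ⟨p, hp⟩ := joinedIn_compl_closure_pullbackDomain hJ hC hφ hD'.carrier_subset hb hz hzc
  set F := closure (φ.pullbackDomain D') with hF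
  have hFne : F.Nonempty := ⟨0, zero_mem_closure_pullbackDomain hφ hD' hsc⟩
  -- positive distance and bounded modulus along the path
  have hK : IsCompact (range p) := isCompact_range p.continuous
  obtain ⟨y, ⟨t₀, rfl⟩, hmin⟩ :=
    hK.exists_isMinOn (range_nonempty p) (continuous_infDist_pt F).continuousOn
  set δ := infDist (p t₀) F with hδdef
  have hδ : 0 < δ := (infDist_pos_iff_notMem_closure hFne).1 (by rw [hF, closure_closure]; exact hp t₀)
  have hδle : ∀ t, δ ≤ infDist (p t) F := fun t ↦ hmin (mem_range_self t)
  obtain ⟨R, hR⟩ := hK.isBounded.subset_closedBall 0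
  -- a far enough erosion
  obtain ⟨n, hn⟩ := exists_nat_gt (max (1 / δ) R)
  have hn1 : 1 / ((n : ℝ) + 1) ≤ δ := by
    rw [div_le_iff₀ (by positivity)]
    have h1 : 1 / δ < n + 1 := (le_max_left _ _).trans_lt (hn.trans (lt_add_one _))
    rw [div_lt_iff₀ hδ] at h1
    linarith
  have hnR : R ≤ (n : ℝ) + 1 := ((le_max_right _ _).trans hn.le).trans (le_add_of_nonneg_right zero_le_one)
  -- the path lies in the complement of the unbounded component of `ℍ ∖ S_n`
  set V := Loewner.unboundedComponent (upperHalfPlaneSet \ erosion φ D' n) with hV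
  have hsub : range p ⊆ Vᶜ := by
    rintro _ ⟨t, rfl⟩ hV'
    have him : 0 < (p t).im := hV'.1.1
    have hS : p t ∈ erosion φ D' n := by
      refine ⟨him.le, ?_, hn1.trans (hδle t)⟩
      exact (mem_closedBall_zero_iff.1 (hR (mem_range_self t))).trans hnR
    exact hV'.1.2 hS
  have hcomp : range p ⊆ anchorComponent (erosion φ D' n) :=
    (isPreconnected_range p.continuous).subset_connectedComponentIn ⟨1, p.target⟩ hsub
  exact ⟨n, subset_closure ⟨hz, hcomp ⟨0, p.source⟩⟩⟩

/-- **The complements of the anchored hulls of the erosions have kernel `ℍ ∖ A`**: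
`int (⋂ₙ (ℍ ∖ B_n)) = ℍ ∖ A`. A point of the interior lies in `closure (ℍ ∖ A)` (else it is
in some `B_n`, `exists_mem_anchoredHull_erosion`), and cannot lie in `A`: its image would be
a point of `∂D' ∩ D`, in the closure of the exterior of the Jordan curve `∂D'`
(`frontier_subset_closure_exterior`), so the open image of the interior would contain points
off `closure D'`, i.e. interior points off `closure (ℍ ∖ A)`. [folklore] -/
theorem interior_iInter_diff_anchoredHull_erosion (hsc : ∀ D : JordanDomain, D.isSimplyConnected)
    (hJ : Literature.Topology.PlaneTopology.JordanCurveTheorem) (hC : JordanDomain.exists_continuousOn_extension) :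
    interior (⋂ n, upperHalfPlaneSet \ anchoredHull (erosion φ D' n)) =
      upperHalfPlaneSet \ φ.pullbackHull D' := by
  set N := interior (⋂ n, upperHalfPlaneSet \ anchoredHull (erosion φ D' n)) with hN
  have hNopen : IsOpen N := isOpen_interior
  have hNsub : N ⊆ ⋂ n, upperHalfPlaneSet \ anchoredHull (erosion φ D' n) := interior_subset
  have hNH : N ⊆ upperHalfPlaneSet := fun z hz ↦ ((mem_iInter.1 (hNsub hz)) 0).1
  -- points of `N` are in `closure (ℍ ∖ A)`
  have hNcl : ∀ z ∈ N, z ∈ closure (φ.pullbackDomain D') := by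
    intro z hz
    by_contra hzc
    obtain ⟨n, hn⟩ := exists_mem_anchoredHull_erosion hφ hD' hsc hJ hC (hNH hz) hzc
    exact ((mem_iInter.1 (hNsub hz)) n).2 hn
  refine Subset.antisymm ?_ ?_
  · intro z hz
    rw [ConformalEquiv.diff_pullbackHull]
    refine ⟨hNH hz, ?_⟩
    by_contra hzD'
    -- `φ z ∈ ∂D'`, in the closure of the exterior of `D'`
    have hφz : φ z ∈ frontier D'.carrier := by
      rw [frontier, D'.isOpen.interior_eq]
      exact ⟨apply_mem_closure_of_mem_closure (hNH hz) (hNcl z hz), hzD'⟩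
    have hext : φ z ∈ closure (closure D'.carrier)ᶜ :=
      D'.toJordanDomain.frontier_subset_closure_exterior hJ hφz
    -- the image `φ(N)` is an open neighbourhood of `φ z` in `D`
    have himg : IsOpen (D.carrier ∩ φ.symm ⁻¹' N) :=
      φ.symm.continuousOn.isOpen_inter_preimage D.isOpen hNopen
    have hmem : φ z ∈ D.carrier ∩ φ.symm ⁻¹' N :=
      ⟨φ.mapsTo (hNH hz), by rw [mem_preimage, φ.symm_apply_apply (hNH hz)]; exact hz⟩
    rw [mem_closure_iff_nhds] at hext
    obtain ⟨w₁, ⟨hw₁D, hw₁N⟩, hw₁⟩ := hext _ (himg.mem_nhds hmem)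
    -- `z₁ = φ⁻¹ w₁ ∈ N` but `φ z₁ = w₁ ∉ closure D'`
    have hz₁ : φ.symm w₁ ∈ N := hw₁N
    have := apply_mem_closure_of_mem_closure (hNH hz₁) (hNcl _ hz₁)
    rw [φ.apply_symm_apply hw₁D] at this
    exact hw₁ this
  · refine interior_maximal (subset_iInter fun n ↦ ?_) ?_
    · intro z hz
      exact ⟨hz.1, fun hzB ↦ hz.2 (anchoredHull_erosion_subset hφ hD' hsc n hzB)⟩
    · rw [ConformalEquiv.diff_pullbackHull]
      exact ConformalEquiv.isOpen_pullbackDomain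

/-- **Touching the pulled-back hull without entering it is a null event for SLE_{8/3}**:
`P[γ(0,∞) ⊆ closure (ℍ ∖ A)] ≤ P[γ[0,∞) ∩ A = ∅]` for the SLE_{8/3} trace `γ` and the
pulled-back hull `A` of a hull subdomain (the two events then agree a.s., the reverse
inclusion holding for simple traces). From [LSW] Thm. 6.1 (`h61`) applied to the exhaustion
`B_n = anchoredHull (erosion n)` of the interior of `A`, the continuity of `Φ'_·(0)` under
kernel convergence (`hFc`, [LSW] Lemma 3.5), existence of the restriction maps and derivatives
(`hexΦ`, `hex`, [LSW] §2), the classical criterion `hFa`, simple connectivity of Jordan domains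
(`hsc`), the Jordan curve theorem (`hJ`), Carathéodory's theorem (`hC`), and the trace facts
(existence `hκt`, simplicity `h₆`, transience `htr`; Rohde–Schramm).
[cite: LawlerSchrammWerner2003Restriction, Thm. 6.1 (p. 23) with Lemma 3.5 (p. 12)] -/
theorem measure_subset_closure_le_measure_avoid (h61 : sle_restriction_eightThirds)
    (hexΦ : IsStarHull.existsUnique_isRestrictionMap) (hex : IsStarHull.exists_hasRestrictionDeriv)
    (hFc : HasRestrictionDeriv.tendsto_of_kernel) (hFa : isSimplyConnected_of_isConnected_compl)
    (hsc : ∀ D : JordanDomain, D.isSimplyConnected) (hJ : Literature.Topology.PlaneTopology.JordanCurveTheorem)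
    (hC : JordanDomain.exists_continuousOn_extension) (hκt : HasSLETrace ((8 : ℝ≥0) / 3))
    (h₆ : RandomPlanarGeometry.ae_isSimpleTrace_sleTrace_of_le_four (κ := (8 : ℝ≥0) / 3))
    (htr : tendsto_norm_sleTrace_atTop) :
    Process.preWienerMeasure {ω | ∀ t, 0 < t →
        sleTrace ((8 : ℝ≥0) / 3) ω t ∈ closure (φ.pullbackDomain D')} ≤
      Process.preWienerMeasure {ω | Disjoint (range (sleTrace ((8 : ℝ≥0) / 3) ω)) (φ.pullbackHull D')} := by
  -- the hull `A`, its restriction map and derivative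
  have hA : IsStarHull (φ.pullbackHull D') := IsStarHull.pullbackHull hsc hφ hD'
  obtain ⟨Φ, hΦ, -⟩ := hexΦ hA
  obtain ⟨d, -, -, hd⟩ := hex hA hΦ
  -- the exhaustion `B_n`
  set B : ℕ → Set ℂ := fun n ↦ anchoredHull (erosion φ D' n) with hB
  have hBstar : ∀ n, IsStarHull (B n) := fun n ↦ isStarHull_anchoredHull_erosion hφ hD' hsc hFa n
  have hBsub : ∀ n, B n ⊆ φ.pullbackHull D' := fun n ↦ anchoredHull_erosion_subset hφ hD' hsc n
  have hBmono : Monotone B := fun n m h ↦ anchoredHull_mono (monotone_erosion h)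
  choose Φn hΦn _ using fun n ↦ hexΦ (hBstar n)
  choose dn _ _ hdn using fun n ↦ hex (hBstar n) (hΦn n)
  have hlim : Tendsto dn atTop (𝓝 d) :=
    hFc hA hBstar hBmono hBsub (interior_iInter_diff_anchoredHull_erosion hφ hD' hsc hJ hC)
      hΦ hd hΦn hdn
  -- Thm. 6.1 for `A` and for the `B_n`
  have hPA := h61 hA hΦ hd
  have hPB : ∀ n, Process.preWienerMeasure {ω | Disjoint (range (sleTrace ((8 : ℝ≥0) / 3) ω)) (B n)} =
      ENNReal.ofReal (dn n ^ ((5 : ℝ) / 8)) := fun n ↦ h61 (hBstar n) (hΦn n) (hdn n)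
  -- the event `{γ(0,∞) ⊆ closure (ℍ ∖ A)}` lies a.s. in every `{γ ∩ B_n = ∅}`
  have hκ0 : (0 : ℝ≥0) < 8 / 3 := by positivity
  have hκ4 : (8 : ℝ≥0) / 3 ≤ 4 := by
    rw [div_le_iff₀ (by norm_num : (0 : ℝ≥0) < 3)]; norm_num
  have hbound : ∀ n, Process.preWienerMeasure {ω | ∀ t, 0 < t →
      sleTrace ((8 : ℝ≥0) / 3) ω t ∈ closure (φ.pullbackDomain D')} ≤
      ENNReal.ofReal (dn n ^ ((5 : ℝ) / 8)) := by
    intro n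
    rw [← hPB n]
    refine measure_mono_ae ?_
    filter_upwards [ae_isGeneratedByCurve_sleTrace hκt, h₆ hκ0 hκ4, htr hκ0] with ω hgen hsimple htr'
    intro hω
    have h0 : sleTrace ((8 : ℝ≥0) / 3) ω 0 = 0 := by
      change Loewner.trace (sleDriving ((8 : ℝ≥0) / 3) ω) 0 = 0
      rw [Loewner.trace_zero, sleDriving_zero, Complex.ofReal_zero]
    have h0S : (0 : ℂ) ∉ erosion φ D' n :=
      notMem_erosion_of_mem_closure (zero_mem_closure_pullbackDomain hφ hD' hsc) n
    have hdisj : Disjoint (range (sleTrace ((8 : ℝ≥0) / 3) ω)) (erosion φ D' n) := by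
      refine Set.disjoint_left.2 ?_
      rintro _ ⟨t, rfl⟩ ht
      rcases eq_or_ne t 0 with rfl | htne
      · exact h0S (h0 ▸ ht)
      · exact notMem_erosion_of_mem_closure (hω t (pos_iff_ne_zero.2 htne)) n ht
    exact disjoint_range_anchoredHull (isClosed_erosion n) (isBounded_erosion n) h0S
      hgen.continuous h0 hsimple.2 htr' hdisj
  -- pass to the limit
  rw [hPA]
  have hlim' : Tendsto (fun n ↦ ENNReal.ofReal (dn n ^ ((5 : ℝ) / 8))) atTop
      (𝓝 (ENNReal.ofReal (d ^ ((5 : ℝ) / 8)))) :=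
    ENNReal.tendsto_ofReal (hlim.rpow_const (Or.inr (by norm_num)))
  exact ge_of_tendsto' hlim' hbound

end Null

end Literature.Probability.RandomPlanarGeometry

end
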